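import Summits.QuantumFields.YangMills.Theorems.MirrorModularBoostsHypercubicLimitPlaneDistDisjointProductBound
import Summits.QuantumFields.YangMills.Theorems.MirrorModularBoostsHypercubicLimitFunctionalBoundPlanes
import Summits.QuantumFields.YangMills.Theorems.MirrorModularBoostsHypercubicLimitPlaneLimitsDefs
import HarnessLib

/-!
# Crux `WeakCouplingHypercubicLimit` (stmt-QuantumFields-16120), line `Sketch`, reshape r13: Gevrey moment bounds suffice

Helper file of the lead (c5).  The common lattice-side core of the cruxes stmt-16120 / stmt-16154 carries, as its UV
conjunct, the `k`-uniform plane-resolved moment bounds `UniformMomentBoundsPlanes r sch` with GAUSSIAN growth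
`|∫ ∏ᵢ Φ^P_k(Fᵢ) dμ_k| ≤ C₀ C₁ⁿ n!` on normalised, pairwise plane-wise disjoint families.  The closure only ever consumes
the `k`-uniform E0′-type FUNCTIONAL bound `UniformFunctionalBoundPlanes r sch` (`‖planeDist_k n q F‖ ≤ α (n!)^β |F|_{n s}`
on `⁰𝒮`), whose currency is already Osterwalder–Schrader's `(n!)^β`.  This file shows that GEVREY growth `C₀ C₁ⁿ (n!)^L`
of the moments (any `L`) gives the same functional bound, so the UV conjunct of the core may be weakened to the OS E0′
currency:

* `gevrey_abs_integral_prod_planeField_le`, `gevrey_planeDist_disjointProductBound` — the twin's Z1b step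
  (`planeDist_disjointProductBound`, real disjoint products by homogeneity, complex products by the `2ⁿ` real/imaginary
  parts) with an ARBITRARY degree-dependent bound `M n` in place of `C₀ C₁ⁿ n!`;
* `functionalBoundPlanes_of_momentBoundsPow` — Gevrey moment bounds ⇒ `UniformFunctionalBoundPlanes` (the twin's
  model-free extension `offDiagonal_bound_explicit` verbatim; exponent `b + L + 1`, constant `C₀ e^{2|C₁|} α`);
* `momentBoundsPow_of_uniformMomentBoundsPlanes` — the Gaussian bounds are the case `L = 1` (the weakening is honest).

Refs: OsterwalderSchrader1973 §2, OsterwalderSchrader1975 §2 and Appendix; GlimmJaffe1987 §6.1, §19.1.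
-/

noncomputable section

open scoped SchwartzMap
open MeasureTheory Filter Topology
open Literature.MathematicalPhysics.AQFT Literature.MathematicalPhysics.QuantumLattice
open Literature.MathematicalPhysics.QuantumFieldTheory
open Summit.QuantumFields.YangMills.Cruxes.HypercubicLimit.CouplingResponse

namespace Summit.QuantumFields.YangMills.Theorems.WeakCouplingHypercubicLimit.TraceNormColdPressure

section Real

variable {G : Type} [Group G] [TopologicalSpace G] [IsTopologicalGroup G] [CompactSpace G]
  [MeasurableSpace G] [BorelSpace G]

/-- **A degree-dependent moment bound is non-negative** (test it on the zero family, which is normalised and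
plane-wise disjoint). [folklore] -/
theorem gevrey_bound_nonneg (r : LatticeRep G) (sch : SpeciesScheme (YMSpecies G)) {s : ℕ} {M : ℕ → ℝ}
    (hU : ∀ (n : ℕ) (F : Fin n → Plane → 𝓢(EuclideanSpace ℝ (Fin 4), ℝ)), (∀ i, normP s (F i) ≤ 1) →
      (∀ i j, i ≠ j → DisjP (F i) (F j)) →
        ∀ k : ℕ, |∫ U, ∏ i, fieldP r sch k (F i) U ∂(wilsonAt r sch k)| ≤ M n)
    (n : ℕ) : 0 ≤ M n := by
  refine (abs_nonneg _).trans (hU n (fun _ _ => 0) (fun i => ?_) (fun i j _ q q' => ?_) 0)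
  · have h0 : normP s ((fun _ : Plane => (0 : 𝓢(EuclideanSpace ℝ (Fin 4), ℝ)))) = 0 := by
      unfold normP
      exact Finset.sum_eq_zero fun q _ => by
        rw [map_zero]
        exact map_zero ((Finset.Iic (s, s)).sup (schwartzSeminormFamily ℂ (EuclideanSpace ℝ (Fin 4)) ℂ))
    rw [h0]
    exact zero_le_one
  · have h0 : tsupport (((fun _ : Plane => (0 : 𝓢(EuclideanSpace ℝ (Fin 4), ℝ))) q) :
        EuclideanSpace ℝ (Fin 4) → ℝ) = ∅ := tsupport_zero
    rw [h0]
    exact Set.empty_disjoint _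

/-- **Step 1 with a general degree-dependent bound** (real disjoint products).  If the anisotropic moments of
normalised, pairwise plane-wise disjoint families obey `|∫ ∏ᵢ Φ^P_k(Fᵢ) dμ_k| ≤ M n`, then for every plane string `q`,
every step `k` and every family of real tests `fᵢ` with pairwise disjoint supports,
`|∫ ∏ᵢ Φ^{qᵢ}_k(fᵢ) dμ_k| ≤ M n ∏ᵢ |fᵢ|_s` (single-plane tuples, normalised by homogeneity; adapted from the twin's
`abs_integral_prod_planeField_le`). [folklore] -/
theorem gevrey_abs_integral_prod_planeField_le (r : LatticeRep G) (sch : SpeciesScheme (YMSpecies G)) {s : ℕ}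
    {M : ℕ → ℝ}
    (hU : ∀ (n : ℕ) (F : Fin n → Plane → 𝓢(EuclideanSpace ℝ (Fin 4), ℝ)), (∀ i, normP s (F i) ≤ 1) →
      (∀ i j, i ≠ j → DisjP (F i) (F j)) →
        ∀ k : ℕ, |∫ U, ∏ i, fieldP r sch k (F i) U ∂(wilsonAt r sch k)| ≤ M n)
    (k n : ℕ) (q : Fin n → Plane) (f : Fin n → 𝓢(EuclideanSpace ℝ (Fin 4), ℝ))
    (hdisj : ∀ i j, i ≠ j →
      Disjoint (tsupport (f i : EuclideanSpace ℝ (Fin 4) → ℝ)) (tsupport (f j : EuclideanSpace ℝ (Fin 4) → ℝ))) :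
    |∫ U, ∏ i, planeField r sch k (q i) (f i) U ∂(wilsonAt r sch k)| ≤
      M n * ∏ i, schwartzNorm s (ofRealTest (f i)) := by
  set N : Fin n → ℝ := fun i => schwartzNorm s (ofRealTest (f i)) with hN
  have hN0 : ∀ i, 0 ≤ N i := fun i => schwartzNorm_nonneg _ _
  by_cases hz : ∃ i, N i = 0
  · -- a factor with vanishing norm vanishes, and so do both sides
    obtain ⟨i₀, hi₀⟩ := hz
    have hf : f i₀ = 0 := eq_zero_of_schwartzNorm_ofRealTest_eq_zero hi₀
    have hprod : (fun U => ∏ i, planeField r sch k (q i) (f i) U) = fun _ => 0 := funext fun U =>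
      Finset.prod_eq_zero (Finset.mem_univ i₀) (by rw [hf, planeField_zero])
    have hrhs : ∏ i, N i = 0 := Finset.prod_eq_zero (Finset.mem_univ i₀) hi₀
    rw [hprod, integral_zero, abs_zero, hrhs, mul_zero]
  · push Not at hz
    have hpos : ∀ i, 0 < N i := fun i => lt_of_le_of_ne (hN0 i) (hz i).symm
    -- the normalised single-plane tuples
    set Fi : Fin n → Plane → 𝓢(EuclideanSpace ℝ (Fin 4), ℝ) := fun i => (N i)⁻¹ • Pi.single (q i) (f i)
      with hFi
    have hfield : ∀ i U, fieldP r sch k (Fi i) U = (N i)⁻¹ * planeField r sch k (q i) (f i) U :=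
      fun i U => by rw [hFi, fieldP_smul, fieldP_single]
    have hnorm : ∀ i, normP s (Fi i) ≤ 1 := fun i => by
      rw [hFi, normP_smul, normP_single, abs_of_pos (inv_pos.2 (hpos i))]
      exact (inv_mul_cancel₀ (hpos i).ne').le
    have hdisjP : ∀ i j, i ≠ j → DisjP (Fi i) (Fi j) := fun i j hij p p' =>
      (hdisj i j hij).mono (tsupport_smul_single_subset _ _ _ _) (tsupport_smul_single_subset _ _ _ _)
    have hkey : (fun U => ∏ i, planeField r sch k (q i) (f i) U) =
        fun U => (∏ i, N i) * ∏ i, fieldP r sch k (Fi i) U := funext fun U => by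
      rw [← Finset.prod_mul_distrib]
      refine Finset.prod_congr rfl fun i _ => ?_
      rw [hfield, ← mul_assoc, mul_inv_cancel₀ (hpos i).ne', one_mul]
    have hPN : 0 ≤ ∏ i, N i := Finset.prod_nonneg fun i _ => hN0 i
    rw [hkey, integral_const_mul, abs_mul, abs_of_nonneg hPN]
    calc (∏ i, N i) * |∫ U, ∏ i, fieldP r sch k (Fi i) U ∂(wilsonAt r sch k)|
        ≤ (∏ i, N i) * M n := mul_le_mul_of_nonneg_left (hU n Fi hnorm hdisjP k) hPN
      _ = M n * ∏ i, N i := by ring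

/-- **Step 2 with a general degree-dependent bound** (complex disjoint products): under the same hypothesis,
`‖planeDist r sch k n q F‖ ≤ 2ⁿ M n ∏ᵢ |φᵢ|_s` for every tensor `F = φ₁ ⊗ ⋯ ⊗ φₙ` of complex one-point tests with
pairwise disjoint supports (`2ⁿ` real disjoint products of real/imaginary parts; adapted from the twin's
`planeDist_disjointProductBound`). [folklore] -/
theorem gevrey_planeDist_disjointProductBound (r : LatticeRep G) (sch : SpeciesScheme (YMSpecies G)) {s : ℕ}
    {M : ℕ → ℝ}
    (hU : ∀ (n : ℕ) (F : Fin n → Plane → 𝓢(EuclideanSpace ℝ (Fin 4), ℝ)), (∀ i, normP s (F i) ≤ 1) →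
      (∀ i j, i ≠ j → DisjP (F i) (F j)) →
        ∀ k : ℕ, |∫ U, ∏ i, fieldP r sch k (F i) U ∂(wilsonAt r sch k)| ≤ M n)
    (k n : ℕ) (q : Fin n → Plane) (φ : Fin n → 𝓢(EuclideanSpace ℝ (Fin 4), ℂ))
    (hdisj : ∀ i j, i ≠ j →
      Disjoint (tsupport (φ i : EuclideanSpace ℝ (Fin 4) → ℂ)) (tsupport (φ j : EuclideanSpace ℝ (Fin 4) → ℂ)))
    (F : 𝓢((Fin n → EuclideanSpace ℝ (Fin 4)), ℂ)) (hF : IsTensorOf F φ) :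
    ‖planeDist r sch k n q F‖ ≤ (2 : ℝ) ^ n * M n * ∏ i, schwartzNorm s (φ i) := by
  have hM : 0 ≤ M n := gevrey_bound_nonneg r sch hU n
  -- the `2ⁿ` families of real and imaginary parts
  set ψ : Finset (Fin n) → Fin n → 𝓢(EuclideanSpace ℝ (Fin 4), ℝ) :=
    fun t i => if i ∈ t then reTest (φ i) else imTest (φ i) with hψ
  have hψsupp : ∀ t i, tsupport (ψ t i : EuclideanSpace ℝ (Fin 4) → ℝ) ⊆
      tsupport (φ i : EuclideanSpace ℝ (Fin 4) → ℂ) := fun t i => by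
    rw [hψ]
    dsimp only
    split_ifs
    · exact tsupport_reTest_subset _
    · exact tsupport_imTest_subset _
  have hψnorm : ∀ t i, schwartzNorm s (ofRealTest (ψ t i)) ≤ schwartzNorm s (φ i) := fun t i => by
    rw [hψ]
    dsimp only
    split_ifs
    · exact schwartzNorm_ofRealTest_reTest_le _ _
    · exact schwartzNorm_ofRealTest_imTest_le _ _
  have hψdisj : ∀ t i j, i ≠ j → Disjoint (tsupport (ψ t i : EuclideanSpace ℝ (Fin 4) → ℝ))
      (tsupport (ψ t j : EuclideanSpace ℝ (Fin 4) → ℝ)) := fun t i j hij =>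
    (hdisj i j hij).mono (hψsupp t i) (hψsupp t j)
  -- each real summand is a Wilson moment, bounded by Step 1 and `|re φ|_s, |im φ|_s ≤ |φ|_s`
  have hterm : ∀ t : Finset (Fin n),
      ‖planeDist r sch k n q (SchwartzMap.tensorFin n (fun i => ofRealTest (ψ t i)))‖ ≤
        M n * ∏ i, schwartzNorm s (φ i) := fun t => by
    rw [planeDist_eq_integral_prod_planeField G r sch k n q (ψ t) _ (isTensorOf_tensorFin _),
      Complex.norm_real, Real.norm_eq_abs]
    refine (gevrey_abs_integral_prod_planeField_le r sch hU k n q (ψ t) (hψdisj t)).trans ?_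
    exact mul_le_mul_of_nonneg_left
      (Finset.prod_le_prod (fun i _ => schwartzNorm_nonneg _ _) fun i _ => hψnorm t i) hM
  -- sum over the `2ⁿ` summands of `eq_sum_tensorFin_reIm`
  rw [eq_sum_tensorFin_reIm φ F hF, map_sum]
  refine (norm_sum_le _ _).trans ?_
  calc ∑ t : Finset (Fin n), ‖planeDist r sch k n q ((Complex.I ^ (n - t.card)) •
          SchwartzMap.tensorFin n (fun i => ofRealTest (ψ t i)))‖
      ≤ ∑ _t : Finset (Fin n), M n * ∏ i, schwartzNorm s (φ i) := by
        refine Finset.sum_le_sum fun t _ => ?_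
        rw [map_smul, norm_smul, norm_pow, Complex.norm_I, one_pow, one_mul]
        exact hterm t
    _ = (2 : ℝ) ^ n * M n * ∏ i, schwartzNorm s (φ i) := by
        rw [Finset.sum_const, Finset.card_univ, Fintype.card_finset, Fintype.card_fin, nsmul_eq_mul]
        push_cast
        ring

end Real

/-- **Gevrey moment bounds ⇒ the `k`-uniform functional bound (smeared → functional, OS currency).**  Along a scheme
whose anisotropic moments obey `|∫ ∏ᵢ Φ^P_k(Fᵢ) dμ_k| ≤ C₀ C₁ⁿ (n!)^L` on normalised, pairwise plane-wise disjoint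
families, every renormalised plane-string distribution obeys `‖planeDist r sch k n q F‖ ≤ α' (n!)^{b+L+1} |F|_{n s₁}`
on `⁰𝒮ₙ`, uniformly in `k` (`offDiagonal_bound_explicit` applied with `M = 2ⁿ C₀ C₁ⁿ (n!)^L`; `(2|C₁|)ⁿ ≤ e^{2|C₁|} n!`).
[cite: OsterwalderSchraderCMP1975, §2 and Appendix] -/
theorem functionalBoundPlanes_of_momentBoundsPow :
    ∀ (G : Type) [Group G] [TopologicalSpace G] [IsTopologicalGroup G] [CompactSpace G]
      [MeasurableSpace G] [BorelSpace G] (r : LatticeRep G) (sch : SpeciesScheme (YMSpecies G)),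
      (∃ (s L : ℕ) (C₀ C₁ : ℝ), ∀ (n : ℕ) (F : Fin n → Plane → 𝓢(EuclideanSpace ℝ (Fin 4), ℝ)),
        (∀ i, normP s (F i) ≤ 1) → (∀ i j, i ≠ j → DisjP (F i) (F j)) →
          ∀ k : ℕ, |∫ U, ∏ i, fieldP r sch k (F i) U ∂(wilsonAt r sch k)| ≤
            C₀ * C₁ ^ n * (n.factorial : ℝ) ^ L) →
      UniformFunctionalBoundPlanes r sch := by
  intro G _ _ _ _ _ _ r sch hUMB
  obtain ⟨s, L, C₀, C₁, hU⟩ := hUMB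
  -- pass to `|C₁|`, so that the bound is monotone-friendly
  have hC₀ : 0 ≤ C₀ := by
    have h := gevrey_bound_nonneg r sch hU 0
    simpa using h
  have hU' : ∀ (n : ℕ) (F : Fin n → Plane → 𝓢(EuclideanSpace ℝ (Fin 4), ℝ)),
      (∀ i, normP s (F i) ≤ 1) → (∀ i j, i ≠ j → DisjP (F i) (F j)) →
        ∀ k : ℕ, |∫ U, ∏ i, fieldP r sch k (F i) U ∂(wilsonAt r sch k)| ≤
          C₀ * |C₁| ^ n * (n.factorial : ℝ) ^ L := fun n F h1 h2 k =>
    (hU n F h1 h2 k).trans (by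
      refine mul_le_mul_of_nonneg_right (mul_le_mul_of_nonneg_left ?_ hC₀) (by positivity)
      rw [← abs_pow]
      exact le_abs_self _)
  obtain ⟨s₁, b, α, hα, hext⟩ := offDiagonal_bound_explicit s
  have hα0 : 0 ≤ α := by linarith
  refine ⟨s₁, C₀ * Real.exp (2 * |C₁|) * α, ((b + L + 1 : ℕ) : ℝ), fun n q F hF k => ?_⟩
  have hMn : 0 ≤ (2 : ℝ) ^ n * (C₀ * |C₁| ^ n * (n.factorial : ℝ) ^ L) := by positivity
  have h := hext n (planeDist r sch k n q) ((2 : ℝ) ^ n * (C₀ * |C₁| ^ n * (n.factorial : ℝ) ^ L)) hMn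
    (fun φ hφ F' hF' => gevrey_planeDist_disjointProductBound r sch hU' k n q φ hφ F' hF') F hF
  have h2C : (2 : ℝ) ^ n * |C₁| ^ n ≤ Real.exp (2 * |C₁|) * (n.factorial : ℝ) := by
    rw [← mul_pow]
    exact pow_le_exp_mul_factorial (by positivity) n
  rw [Real.rpow_natCast]
  calc ‖planeDist r sch k n q F‖
      ≤ (2 : ℝ) ^ n * (C₀ * |C₁| ^ n * (n.factorial : ℝ) ^ L) * (α * (n.factorial : ℝ) ^ b) *
          schwartzNorm (n * s₁) F := h
    _ = C₀ * ((2 : ℝ) ^ n * |C₁| ^ n) * α * ((n.factorial : ℝ) ^ L * (n.factorial : ℝ) ^ b) *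
          schwartzNorm (n * s₁) F := by ring
    _ ≤ C₀ * (Real.exp (2 * |C₁|) * (n.factorial : ℝ)) * α * ((n.factorial : ℝ) ^ L * (n.factorial : ℝ) ^ b) *
          schwartzNorm (n * s₁) F := by
        gcongr
        exact schwartzNorm_nonneg _ _
    _ = C₀ * Real.exp (2 * |C₁|) * α * (n.factorial : ℝ) ^ (b + L + 1) * schwartzNorm (n * s₁) F := by ring

/-- **The Gaussian moment bounds are Gevrey bounds with `L = 1`**: `UniformMomentBoundsPlanes r sch` implies the
pow-form hypothesis of `functionalBoundPlanes_of_momentBoundsPow` (so the Gevrey core is implied by the common core).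
[folklore] -/
theorem momentBoundsPow_of_uniformMomentBoundsPlanes {G : Type} [Group G] [TopologicalSpace G]
    [IsTopologicalGroup G] [CompactSpace G] [MeasurableSpace G] [BorelSpace G] (r : LatticeRep G)
    (sch : SpeciesScheme (YMSpecies G)) (h : UniformMomentBoundsPlanes r sch) :
    ∃ (s L : ℕ) (C₀ C₁ : ℝ), ∀ (n : ℕ) (F : Fin n → Plane → 𝓢(EuclideanSpace ℝ (Fin 4), ℝ)),
      (∀ i, normP s (F i) ≤ 1) → (∀ i j, i ≠ j → DisjP (F i) (F j)) →
        ∀ k : ℕ, |∫ U, ∏ i, fieldP r sch k (F i) U ∂(wilsonAt r sch k)| ≤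
          C₀ * C₁ ^ n * (n.factorial : ℝ) ^ L := by
  obtain ⟨s, C₀, C₁, h⟩ := h
  exact ⟨s, 1, C₀, C₁, fun n F h1 h2 k => by simpa only [pow_one] using h n F h1 h2 k⟩

end Summit.QuantumFields.YangMills.Theorems.WeakCouplingHypercubicLimit.TraceNormColdPressure

end
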